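import Summits.HubbardSuperconductivity.HubbardSuperconductivity.Theorems.BirGroundStateAverageLRO.Negative.SpinCeilingDownBound
import Literature.MathematicalPhysics.QuantumLattice.HubbardRingPerronFrobeniusProofs

/-!
# Crux `BirGroundStateAverageLRO` (item `stmt-HubbardSuperconductivity-2079`), spin corner II: the `su(2)` ladder and the operator inequality `Δ_g† Δ_g ≤ (C_g L²/(n+1)) (n(n+1) - S²)`

Second of three files on the SPIN CEILING (see `SpinCeilingDownBound.lean`). For the `S^z = 0` sector
`(n, n)` (`N = 2n` electrons) of the fermionic torus of side `L` and every form factor `g`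
(`C_g = 10 Σ_e g(e)²`, `C_d = 40`):

* `re_normSq_pairField_mulVec_le_ladder` — **the raising ladder**: on the sector `(a, b)`, `b ≤ a`,
  for an `S²`-eigenvector (`λ`) and `k ≤ b` with `(m+j)(m+j+1) < λ` for `j < k` (`m = (a-b)/2`):
  `‖Δ_g ψ‖² ≤ C_g L² (b - k) ‖ψ‖²`. Each raising by `S⁺` (which commutes with `Δ_g` and `S²`, tree
  `NoGo.spinSq_commute_pairField`, `PairChirality.spin_commute_localPair`) multiplies `‖ψ‖²` and
  `‖Δ_g ψ‖²` by the SAME factor `λ - m'(m'+1) > 0` (tree `NoGo.star_spinPlus_mulVec_dotProduct`: `Δ_g ψ`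
  has the weight and the `S²`-eigenvalue of `ψ`) and removes one down electron, until the down-electron
  bound `norm_sq_pairField_mulVec_le_of_isInSector` is applied;
* `re_normSq_pairField_mulVec_le_of_spin` — **a state of total spin `S` (`S² ψ = S(S+1) ψ`) in the
  `S^z = 0` sector has `‖Δ_g ψ‖² ≤ C_g L² (n - S) ‖ψ‖²`**: the singlet-pair amplitude of a state with
  only `N/2 - S` down electrons (`S = N/2`: zero, route NoGo crux 5);
  `re_normSq_pairField_mulVec_le_of_spinSq_eigen` — the form linear in the eigenvalue,
  `≤ (C_g L²/(n+1)) (n(n+1) - λ) ‖ψ‖²`;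
* `star_dotProduct_mulVec_eq_zero_of_eigen`, `sectorProj_finset_sum` — bookkeeping for the spectral
  decomposition of `S²` inside the sector (Mathlib `Matrix.IsHermitian.eigenvectorBasis`, grouped by
  eigenvalue and projected back by `sectorProj`, `NoGo.preservesSectors_spinSq`);
* `re_normSq_pairField_mulVec_le_spinDeficit` — **for EVERY `ψ` of the sector `(n, n)`:
  `‖Δ_g ψ‖² ≤ (C_g L²/(n+1)) · (n(n+1) ‖ψ‖² - Re ⟨ψ, S² ψ⟩)`**, i.e. the operator inequality
  `Δ_g† Δ_g ≤ (C_g L²/(n+1)) (S_max(S_max+1) - S²)` on the sector (`S_max = n`): pair-field order is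
  bounded by the SPIN DEFICIT; `re_normSq_pairField_dWave_mulVec_le_spinDeficit` — the `d`-wave case.

Sources: H. Tasaki, *Physics and Mathematics of Quantum Many-Body Systems* (2020) §2.4 (angular
momentum ladder, norms of `S^± v`), App. A; H. Tasaki, Prog. Theor. Phys. 99 (1998) 489, p. 20;
E. H. Lieb, PRL 62 (1989) 1201 (`S ≤ N/2`, sectors); D. J. Scalapino, Phys. Rep. 250 (1995) 329, §2.
Folklore; no definition and no named fact is introduced; nothing here asserts a Theses decl.
-/

noncomputable section

namespace Summit.HubbardSuperconductivity.HubbardSuperconductivity.Theorems.BirGroundStateAverageLRO.Negative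

set_option linter.dupNamespace false

open Matrix Finset Filter
open Literature.Probability.LatticeModels Literature.MathematicalPhysics.QuantumLattice
open Summit.HubbardSuperconductivity.HubbardSuperconductivity.Theorems
open scoped ComplexOrder

section LadderTorus

variable (g : Site 2 → ℝ) (L : ℕ) [NeZero L]

/-- **The raising ladder.** Let `ψ` lie in the sector `(a, b)` with `b ≤ a` (weight
`m = (a-b)/2 ≥ 0`) and `S² ψ = λ ψ`, and let `k ≤ b` be such that `(m+j)(m+j+1) < λ` for all `j < k`.
Then `‖Δ_g ψ‖² ≤ 10 L² (Σ_e g(e)²) (b - k) ‖ψ‖²`: raise `k` times with `S⁺`, which commutes with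
`Δ_g` and `S²`, multiplies BOTH `‖ψ‖²` and `‖Δ_g ψ‖²` by the same factor `λ - (m+j)(m+j+1) > 0`
(`‖S⁺ φ‖² = (λ - m'(m'+1)) ‖φ‖²` on a weight-`m'` eigenvector — `Δ_g ψ` has the same weight and the same
`S²`-eigenvalue as `ψ`), and lands in the sector `(a+k, b-k)` where the down-electron bound
`norm_sq_pairField_mulVec_le_of_isInSector` applies. Tasaki (2020) §2.4 (raising/lowering norms);
Tasaki, Prog. Theor. Phys. 99 (1998) 489, p. 20. [folklore] -/
theorem re_normSq_pairField_mulVec_le_ladder :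
    ∀ (k : ℕ) {a b : ℕ} {ψ : Fock (Orb (FermionTorus 2 L))} {lam : ℝ},
      IsInSector a b ψ → b ≤ a → k ≤ b →
      spinSq *ᵥ ψ = (lam : ℂ) • ψ →
      (∀ j : ℕ, j < k → (((a : ℝ) - b) / 2 + j) * (((a : ℝ) - b) / 2 + j + 1) < lam) →
      (star (pairField g L *ᵥ ψ) ⬝ᵥ (pairField g L *ᵥ ψ)).re ≤
        10 * (L : ℝ) ^ 2 * (∑ e ∈ insert (0 : Site 2) unitSteps, g e ^ 2) * ((b : ℝ) - k) *
          (star ψ ⬝ᵥ ψ).re := by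
  intro k
  induction k with
  | zero =>
    intro a b ψ lam hψ _ _ _ _
    rw [← norm_toLp_sq_eq_re, Nat.cast_zero, sub_zero]
    exact norm_sq_pairField_mulVec_le_of_isInSector g L hψ
  | succ k ih =>
    intro a b ψ lam hψ hba hkb hS hcond
    -- `b = b' + 1`, `a = a' + 1`
    obtain ⟨b', rfl⟩ : ∃ b', b = b' + 1 := ⟨b - 1, by omega⟩
    obtain ⟨a', rfl⟩ : ∃ a', a = a' + 1 := ⟨a - 1, by omega⟩
    -- the common factor `κ = λ - m(m+1) > 0`
    set κ : ℝ := lam - ((((a' + 1 : ℕ) : ℝ) - ((b' + 1 : ℕ) : ℝ)) / 2 *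
      ((((a' + 1 : ℕ) : ℝ) - ((b' + 1 : ℕ) : ℝ)) / 2) + (((a' + 1 : ℕ) : ℝ) - ((b' + 1 : ℕ) : ℝ)) / 2) with hκ
    have hκpos : 0 < κ := by
      have h0 := hcond 0 (Nat.succ_pos k)
      simp only [Nat.cast_zero, add_zero] at h0
      rw [hκ]; push_cast at h0 ⊢; nlinarith
    -- norms after raising
    have hnormψ : (star (spinPlus *ᵥ ψ) ⬝ᵥ (spinPlus *ᵥ ψ)).re = κ * (star ψ ⬝ᵥ ψ).re := by
      rw [NoGo.star_spinPlus_mulVec_dotProduct hψ hS]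
      have hc : ((lam : ℂ) - (1 / 2 * (((a' + 1 : ℕ) : ℂ) - ((b' + 1 : ℕ) : ℂ))) *
          (1 / 2 * (((a' + 1 : ℕ) : ℂ) - ((b' + 1 : ℕ) : ℂ))) -
          1 / 2 * (((a' + 1 : ℕ) : ℂ) - ((b' + 1 : ℕ) : ℂ))) = (κ : ℂ) := by
        rw [hκ]; push_cast; ring
      rw [hc, Complex.re_ofReal_mul]
    have hΔψ : IsInSector a' b' (pairField g L *ᵥ ψ) := isInSector_pairField_mulVec g L hψ
    have hSΔψ : spinSq *ᵥ (pairField g L *ᵥ ψ) = (lam : ℂ) • (pairField g L *ᵥ ψ) := by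
      rw [mulVec_mulVec, (NoGo.spinSq_commute_pairField g L).eq, ← mulVec_mulVec, hS, mulVec_smul]
    have hnormΔ : (star (spinPlus *ᵥ (pairField g L *ᵥ ψ)) ⬝ᵥ (spinPlus *ᵥ (pairField g L *ᵥ ψ))).re =
        κ * (star (pairField g L *ᵥ ψ) ⬝ᵥ (pairField g L *ᵥ ψ)).re := by
      rw [NoGo.star_spinPlus_mulVec_dotProduct hΔψ hSΔψ]
      have hc : ((lam : ℂ) - (1 / 2 * ((a' : ℂ) - (b' : ℂ))) * (1 / 2 * ((a' : ℂ) - (b' : ℂ))) -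
          1 / 2 * ((a' : ℂ) - (b' : ℂ))) = (κ : ℂ) := by
        rw [hκ]; push_cast; ring
      rw [hc, Complex.re_ofReal_mul]
    -- the raised vector
    have hφ : IsInSector (a' + 1 + 1) b' (spinPlus *ᵥ ψ) := LiebThm1.raisesSpin_spinPlus.isInSector_mulVec hψ
    have hSφ : spinSq *ᵥ (spinPlus *ᵥ ψ) = (lam : ℂ) • (spinPlus *ᵥ ψ) := by
      have hc : (spinSq * spinPlus : Matrix (Finset (Orb (FermionTorus 2 L))) _ ℂ) = spinPlus * spinSq := by
        rw [← LiebTwo.su2Casimir_spin_eq_spinSq]; exact LiebTwo.isSu2Triple_spin.su2Casimir_mul_P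
      rw [mulVec_mulVec, hc, ← mulVec_mulVec, hS, mulVec_smul]
    have hcond' : ∀ j : ℕ, j < k →
        ((((a' + 1 + 1 : ℕ) : ℝ) - b') / 2 + j) * ((((a' + 1 + 1 : ℕ) : ℝ) - b') / 2 + j + 1) < lam := by
      intro j hj
      have h := hcond (j + 1) (by omega)
      push_cast at h ⊢
      have e1 : (((a' : ℝ) + 1 + 1 - b') / 2 + j) = (((a' : ℝ) + 1 - (b' + 1)) / 2 + (j + 1)) := by ring
      rw [e1]; exact h
    have hIH := ih hφ (by omega) (by omega) hSφ hcond'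
    -- `Δ (S⁺ ψ) = S⁺ (Δ ψ)` (`Δ_g` is a sum of singlet pairs, each commuting with `S⁺`)
    have hSP : Commute (spinPlus : Matrix (Finset (Orb (FermionTorus 2 L))) _ ℂ) (pairField g L) := by
      rw [pairField]
      exact Commute.sum_right _ _ _ fun x _ => (PairChirality.spin_commute_localPair L g x).1
    have hcomm : pairField g L *ᵥ (spinPlus *ᵥ ψ) = spinPlus *ᵥ (pairField g L *ᵥ ψ) := by
      rw [mulVec_mulVec, ← hSP.eq, ← mulVec_mulVec]
    rw [hcomm, hnormΔ, hnormψ] at hIH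
    -- divide by `κ > 0`
    have hkey : (star (pairField g L *ᵥ ψ) ⬝ᵥ (pairField g L *ᵥ ψ)).re ≤
        10 * (L : ℝ) ^ 2 * (∑ e ∈ insert (0 : Site 2) unitSteps, g e ^ 2) * ((b' : ℝ) - k) *
          (star ψ ⬝ᵥ ψ).re := by
      refine le_of_mul_le_mul_left ?_ hκpos
      calc κ * (star (pairField g L *ᵥ ψ) ⬝ᵥ (pairField g L *ᵥ ψ)).re
          ≤ 10 * (L : ℝ) ^ 2 * (∑ e ∈ insert (0 : Site 2) unitSteps, g e ^ 2) * ((b' : ℝ) - k) *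
              (κ * (star ψ ⬝ᵥ ψ).re) := hIH
        _ = κ * (10 * (L : ℝ) ^ 2 * (∑ e ∈ insert (0 : Site 2) unitSteps, g e ^ 2) * ((b' : ℝ) - k) *
              (star ψ ⬝ᵥ ψ).re) := by ring
    convert hkey using 3
    push_cast; ring

/-- **Spin ceiling, eigenvector form (`S^z = 0`).** For `ψ` in the sector `(n, n)` (`N = 2n`
electrons, `S^z = 0`) with total spin `S`, i.e. `S² ψ = S(S+1) ψ`, `S ≥ 0`:
`‖Δ_g ψ‖² ≤ 10 L² (Σ_e g(e)²) · (n - S) · ‖ψ‖²` — a state of total spin `S` carries at most the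
singlet-pair amplitude of a state with `N/2 - S` down electrons; `S = N/2` (saturated ferromagnet)
gives `Δ_g ψ = 0` (route NoGo, `NoGo.pairField_mulVec_eq_zero_of_saturated`). The ladder is climbed
`⌈S⌉` times (`j < ⌈S⌉ ⇒ j(j+1) < S(S+1)`); for `S > n` the vector vanishes (`S ≤ N/2`,
`NoGo.eq_zero_of_isInSector_of_spinSq_mulVec`). Tasaki (2020) §2.4; Tasaki, Prog. Theor. Phys. 99
(1998) 489, p. 20; Lieb, PRL 62 (1989) 1201. [folklore] -/
theorem re_normSq_pairField_mulVec_le_of_spin {n : ℕ} {ψ : Fock (Orb (FermionTorus 2 L))} {S : ℝ}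
    (hψ : IsInSector n n ψ) (hS0 : 0 ≤ S)
    (hS : spinSq *ᵥ ψ = ((S * (S + 1) : ℝ) : ℂ) • ψ) :
    (star (pairField g L *ᵥ ψ) ⬝ᵥ (pairField g L *ᵥ ψ)).re ≤
      10 * (L : ℝ) ^ 2 * (∑ e ∈ insert (0 : Site 2) unitSteps, g e ^ 2) * ((n : ℝ) - S) *
        (star ψ ⬝ᵥ ψ).re := by
  rcases lt_or_ge (n : ℝ) S with hlt | hle
  · -- `S > n = N/2`: the vector vanishes
    have h0 : ψ = 0 := by
      refine NoGo.eq_zero_of_isInSector_of_spinSq_mulVec n n ψ (S * (S + 1)) hψ hS ?_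
      have : ((n : ℝ) + n) / 2 = n := by ring
      rw [this]; nlinarith
    subst h0
    simp
  · set k : ℕ := ⌈S⌉₊ with hk
    have hkn : k ≤ n := Nat.ceil_le.2 hle
    have hcond : ∀ j : ℕ, j < k → (((n : ℝ) - n) / 2 + j) * (((n : ℝ) - n) / 2 + j + 1) < S * (S + 1) := by
      intro j hj
      have hjS : (j : ℝ) < S := Nat.lt_ceil.1 hj
      have hj0 : (0 : ℝ) ≤ j := Nat.cast_nonneg j
      rw [sub_self, zero_div, zero_add]
      nlinarith
    have h := re_normSq_pairField_mulVec_le_ladder g L k hψ le_rfl hkn hS hcond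
    refine h.trans ?_
    have hkS : S ≤ (k : ℝ) := Nat.le_ceil S
    have hnn : 0 ≤ (star ψ ⬝ᵥ ψ).re := by rw [← norm_toLp_sq_eq_re]; positivity
    have hC : 0 ≤ 10 * (L : ℝ) ^ 2 * (∑ e ∈ insert (0 : Site 2) unitSteps, g e ^ 2) :=
      mul_nonneg (by positivity) (Finset.sum_nonneg fun e _ => sq_nonneg _)
    have : ((n : ℝ) - k) ≤ ((n : ℝ) - S) := by linarith
    exact mul_le_mul_of_nonneg_right (mul_le_mul_of_nonneg_left this hC) hnn

/-- **Spin ceiling, linear form.** For `ψ` in the sector `(n, n)` with `S² ψ = λ ψ`: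
`‖Δ_g ψ‖² ≤ (10 L² Σ_e g(e)² / (n+1)) · (n(n+1) - λ) · ‖ψ‖²` (with `λ = S(S+1)`:
`n - S ≤ (n(n+1) - S(S+1))/(n+1)` for `0 ≤ S ≤ n`). This form is additive over an
`S²`-eigendecomposition. Tasaki (2020) §2.4. [folklore] -/
theorem re_normSq_pairField_mulVec_le_of_spinSq_eigen {n : ℕ} {ψ : Fock (Orb (FermionTorus 2 L))}
    {lam : ℝ} (hψ : IsInSector n n ψ) (hS : spinSq *ᵥ ψ = (lam : ℂ) • ψ) :
    (star (pairField g L *ᵥ ψ) ⬝ᵥ (pairField g L *ᵥ ψ)).re ≤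
      10 * (L : ℝ) ^ 2 * (∑ e ∈ insert (0 : Site 2) unitSteps, g e ^ 2) / ((n : ℝ) + 1) *
        (((n : ℝ) * (n + 1) - lam) * (star ψ ⬝ᵥ ψ).re) := by
  rcases lt_or_ge lam 0 with hneg | hlam
  · have h0 := eq_zero_of_spinSq_mulVec_of_neg hS hneg
    subst h0; simp
  · -- `λ = S(S+1)` with `S = (√(1+4λ) - 1)/2 ≥ 0`
    set S : ℝ := (Real.sqrt (1 + 4 * lam) - 1) / 2 with hSdef
    have hsq : Real.sqrt (1 + 4 * lam) ^ 2 = 1 + 4 * lam := Real.sq_sqrt (by linarith)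
    have hS1 : 1 ≤ Real.sqrt (1 + 4 * lam) := by
      have h := Real.sqrt_le_sqrt (show (1 : ℝ) ≤ 1 + 4 * lam by linarith)
      rwa [Real.sqrt_one] at h
    have hS0 : 0 ≤ S := by rw [hSdef]; linarith
    have hSS : S * (S + 1) = lam := by rw [hSdef]; nlinarith
    have hS' : spinSq *ᵥ ψ = ((S * (S + 1) : ℝ) : ℂ) • ψ := by rw [hSS]; exact hS
    have h := re_normSq_pairField_mulVec_le_of_spin g L hψ hS0 hS'
    rcases lt_or_ge (n : ℝ) S with hlt | hle
    · have h0 : ψ = 0 := by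
        refine NoGo.eq_zero_of_isInSector_of_spinSq_mulVec n n ψ (S * (S + 1)) hψ hS' ?_
        have : ((n : ℝ) + n) / 2 = n := by ring
        rw [this]; nlinarith
      subst h0; simp
    · refine h.trans ?_
      have hnn : 0 ≤ (star ψ ⬝ᵥ ψ).re := by rw [← norm_toLp_sq_eq_re]; positivity
      have hC : 0 ≤ 10 * (L : ℝ) ^ 2 * (∑ e ∈ insert (0 : Site 2) unitSteps, g e ^ 2) :=
        mul_nonneg (by positivity) (Finset.sum_nonneg fun e _ => sq_nonneg _)
      have hn1 : (0 : ℝ) < (n : ℝ) + 1 := by positivity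
      rw [← hSS]
      -- `C (n - S) ≤ C/(n+1) · (n(n+1) - S(S+1)) = C (n - S) (n + S + 1)/(n+1)`
      have key : ((n : ℝ) - S) ≤ ((n : ℝ) * (n + 1) - S * (S + 1)) / ((n : ℝ) + 1) := by
        rw [le_div_iff₀ hn1]; nlinarith
      calc 10 * (L : ℝ) ^ 2 * (∑ e ∈ insert (0 : Site 2) unitSteps, g e ^ 2) * ((n : ℝ) - S) *
            (star ψ ⬝ᵥ ψ).re
          ≤ 10 * (L : ℝ) ^ 2 * (∑ e ∈ insert (0 : Site 2) unitSteps, g e ^ 2) *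
            (((n : ℝ) * (n + 1) - S * (S + 1)) / ((n : ℝ) + 1)) * (star ψ ⬝ᵥ ψ).re :=
            mul_le_mul_of_nonneg_right (mul_le_mul_of_nonneg_left key hC) hnn
        _ = _ := by field_simp

end LadderTorus


/-! ### Every state of the `S^z = 0` sector: the spin ceiling as an operator inequality `Δ_g† Δ_g ≤ (C/(n+1)) (n(n+1) - S²)` -/

section Decomposition

variable {m : Type*} [Fintype m]

/-- Eigenvectors of a Hermitian `A` with different eigenvalues stay orthogonal under any `B`
commuting with `A`: `⟨u, B v⟩ = 0`. [folklore] -/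
theorem star_dotProduct_mulVec_eq_zero_of_eigen {A B : Matrix m m ℂ} (hA : Aᴴ = A)
    (hAB : A * B = B * A) {u v : m → ℂ} {μ ν : ℝ} (hu : A *ᵥ u = (μ : ℂ) • u)
    (hv : A *ᵥ v = (ν : ℂ) • v) (hne : μ ≠ ν) : star u ⬝ᵥ (B *ᵥ v) = 0 := by
  have h1 : star u ⬝ᵥ (A *ᵥ (B *ᵥ v)) = (ν : ℂ) * (star u ⬝ᵥ (B *ᵥ v)) := by
    rw [mulVec_mulVec, hAB, ← mulVec_mulVec, hv, mulVec_smul, dotProduct_smul, smul_eq_mul]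
  have h2 : star u ⬝ᵥ (A *ᵥ (B *ᵥ v)) = (μ : ℂ) * (star u ⬝ᵥ (B *ᵥ v)) := by
    have hsu : star (A *ᵥ u) = (μ : ℂ) • star u := by
      rw [hu, star_smul, Complex.star_def, Complex.conj_ofReal]
    rw [dotProduct_mulVec, show star u ᵥ* A = star (A *ᵥ u) by rw [star_mulVec, hA], hsu,
      smul_dotProduct, smul_eq_mul]
  have h3 : ((ν : ℂ) - μ) * (star u ⬝ᵥ (B *ᵥ v)) = 0 := by rw [sub_mul, ← h1, ← h2, sub_self]
  rcases mul_eq_zero.1 h3 with h | h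
  · exfalso
    apply hne
    have h' : (ν : ℂ) = μ := sub_eq_zero.1 h
    exact_mod_cast h'.symm
  · exact h

variable {Λ : Type*} [LinearOrder Λ] [Fintype Λ]

/-- `sectorProj` is additive over finite sums. [folklore] -/
theorem sectorProj_finset_sum {ι : Type*} (a b : ℕ) (s : Finset ι) (f : ι → Fock (Orb Λ)) :
    sectorProj a b (∑ i ∈ s, f i) = ∑ i ∈ s, sectorProj a b (f i) := by
  funext t
  simp only [sectorProj_apply, Finset.sum_apply]
  split_ifs with h
  · rfl
  · simp

end Decomposition

section Operator

variable (g : Site 2 → ℝ) (L : ℕ) [NeZero L]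

/-- **Spin ceiling for every state of the `S^z = 0` sector.** For every vector `ψ` of the sector
`(n, n)` (`N = 2n` electrons, `S^z = 0`) of the fermionic torus and every form factor `g`:
`‖Δ_g ψ‖² ≤ (10 L² Σ_e g(e)² / (n+1)) · (n(n+1) ‖ψ‖² - Re ⟨ψ, S² ψ⟩)`, i.e. the operator inequality
`Δ_g† Δ_g ≤ (C_g L²/(n+1)) (S_max(S_max+1) - S²)`, `S_max = n = N/2`, on the sector: pair-field order is
bounded by the SPIN DEFICIT. Proof: expand `ψ` in an orthonormal eigenbasis of the Hermitian matrix
`S²` (Mathlib `Matrix.IsHermitian.eigenvectorBasis`), group by eigenvalue and project each group back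
to the sector (`S²` is block diagonal, `NoGo.preservesSectors_spinSq`); the components are
`S²`-eigenvectors IN the sector, mutually orthogonal also under `Δ_g† Δ_g` and `S²` (which commute with
`S²`), and the eigenvector form `re_normSq_pairField_mulVec_le_of_spinSq_eigen` is additive.
Tasaki (2020) §2.4, App. A; Tasaki, Prog. Theor. Phys. 99 (1998) 489, p. 20. [folklore] -/
theorem re_normSq_pairField_mulVec_le_spinDeficit {n : ℕ} {ψ : Fock (Orb (FermionTorus 2 L))}
    (hψ : IsInSector n n ψ) :
    (star (pairField g L *ᵥ ψ) ⬝ᵥ (pairField g L *ᵥ ψ)).re ≤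
      10 * (L : ℝ) ^ 2 * (∑ e ∈ insert (0 : Site 2) unitSteps, g e ^ 2) / ((n : ℝ) + 1) *
        ((n : ℝ) * (n + 1) * (star ψ ⬝ᵥ ψ).re -
          (star ψ ⬝ᵥ ((spinSq : Matrix (Finset (Orb (FermionTorus 2 L))) _ ℂ) *ᵥ ψ)).re) := by
  classical
  have hA : (spinSq : Matrix (Finset (Orb (FermionTorus 2 L))) _ ℂ).IsHermitian :=
    LiebTwo.spinSq_conjTranspose
  set bs := hA.eigenvectorBasis with hbs
  set x : EuclideanSpace ℂ (Finset (Orb (FermionTorus 2 L))) := WithLp.toLp 2 ψ with hx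
  set T : Finset ℝ := Finset.univ.image hA.eigenvalues with hT
  -- spectral components of `ψ`, projected back to the sector
  set φ : ℝ → Fock (Orb (FermionTorus 2 L)) := fun μ => sectorProj n n
    (∑ i ∈ Finset.univ.filter (fun i => hA.eigenvalues i = μ),
      (inner ℂ (bs i) x) • (WithLp.ofLp (bs i) : Fock (Orb (FermionTorus 2 L)))) with hφ
  have hφsec : ∀ μ, IsInSector n n (φ μ) := fun μ => isInSector_sectorProj n n _
  have hφeig : ∀ μ : ℝ, spinSq *ᵥ φ μ = (μ : ℂ) • φ μ := by
    intro μ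
    simp only [hφ]
    rw [NoGo.preservesSectors_spinSq.mulVec_sectorProj, ← sectorProj_smul]
    congr 1
    rw [Matrix.mulVec_sum, Finset.smul_sum]
    refine Finset.sum_congr rfl fun i hi => ?_
    rw [Finset.mem_filter] at hi
    rw [mulVec_smul, smul_comm]
    congr 1
    rw [hbs, hA.mulVec_eigenvectorBasis i, hi.2]
    funext k
    simp only [Pi.smul_apply, Complex.real_smul, smul_eq_mul]
  have hsum : ∑ μ ∈ T, φ μ = ψ := by
    simp only [hφ]
    rw [← sectorProj_finset_sum,
      Finset.sum_fiberwise_of_maps_to (fun i _ => Finset.mem_image_of_mem _ (Finset.mem_univ i))]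
    have hrepr : ∑ i, (inner ℂ (bs i) x) • (WithLp.ofLp (bs i) : Fock (Orb (FermionTorus 2 L))) = ψ := by
      have h := congrArg WithLp.ofLp (bs.sum_repr' x)
      rw [WithLp.ofLp_sum] at h
      simpa only [WithLp.ofLp_smul, hx, WithLp.ofLp_toLp] using h
    rw [hrepr, sectorProj_eq_self hψ]
  -- operators commuting with `S²` are diagonal across the components
  have hdiag : ∀ B : Matrix (Finset (Orb (FermionTorus 2 L))) (Finset (Orb (FermionTorus 2 L))) ℂ,
      spinSq * B = B * spinSq →
      star ψ ⬝ᵥ (B *ᵥ ψ) = ∑ μ ∈ T, star (φ μ) ⬝ᵥ (B *ᵥ φ μ) := by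
    intro B hB
    conv_lhs => rw [← hsum]
    rw [Matrix.mulVec_sum, star_sum, sum_dotProduct]
    refine Finset.sum_congr rfl fun μ hμ => ?_
    rw [dotProduct_sum]
    refine Finset.sum_eq_single_of_mem μ hμ fun ν _ hne => ?_
    exact star_dotProduct_mulVec_eq_zero_of_eigen hA.eq hB (hφeig μ) (hφeig ν) (Ne.symm hne)
  -- `Δ† Δ` commutes with `S²`
  have hΔcomm : Commute (spinSq : Matrix (Finset (Orb (FermionTorus 2 L))) _ ℂ)
      ((pairField g L)ᴴ * pairField g L) := by
    have h1 := NoGo.spinSq_commute_pairField g L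
    have h2 : Commute (spinSq : Matrix (Finset (Orb (FermionTorus 2 L))) _ ℂ) (pairField g L)ᴴ := by
      have h := congrArg conjTranspose h1.eq
      simp only [conjTranspose_mul, hA.eq] at h
      exact h.symm
    exact h2.mul_right h1
  -- the three expansions
  have hL : (star (pairField g L *ᵥ ψ) ⬝ᵥ (pairField g L *ᵥ ψ)).re =
      ∑ μ ∈ T, (star (pairField g L *ᵥ φ μ) ⬝ᵥ (pairField g L *ᵥ φ μ)).re := by
    rw [← LiebThm1.star_dotProduct_conjTranspose_mul_mulVec, hdiag _ hΔcomm.eq, Complex.re_sum]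
    refine Finset.sum_congr rfl fun μ _ => ?_
    rw [LiebThm1.star_dotProduct_conjTranspose_mul_mulVec]
  have h1 : (star ψ ⬝ᵥ ψ).re = ∑ μ ∈ T, (star (φ μ) ⬝ᵥ φ μ).re := by
    have h := hdiag 1 (by rw [Matrix.mul_one, Matrix.one_mul])
    simp only [Matrix.one_mulVec] at h
    rw [h, Complex.re_sum]
  have h2 : (star ψ ⬝ᵥ ((spinSq : Matrix (Finset (Orb (FermionTorus 2 L))) _ ℂ) *ᵥ ψ)).re =
      ∑ μ ∈ T, μ * (star (φ μ) ⬝ᵥ φ μ).re := by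
    rw [hdiag spinSq rfl, Complex.re_sum]
    refine Finset.sum_congr rfl fun μ _ => ?_
    rw [hφeig μ, dotProduct_smul, smul_eq_mul, Complex.re_ofReal_mul]
  rw [hL, h1, h2]
  calc ∑ μ ∈ T, (star (pairField g L *ᵥ φ μ) ⬝ᵥ (pairField g L *ᵥ φ μ)).re
      ≤ ∑ μ ∈ T, (10 * (L : ℝ) ^ 2 * (∑ e ∈ insert (0 : Site 2) unitSteps, g e ^ 2) / ((n : ℝ) + 1) *
          (((n : ℝ) * (n + 1) - μ) * (star (φ μ) ⬝ᵥ φ μ).re)) :=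
        Finset.sum_le_sum fun μ _ =>
          re_normSq_pairField_mulVec_le_of_spinSq_eigen g L (hφsec μ) (hφeig μ)
    _ = _ := by
        rw [← Finset.mul_sum]
        congr 1
        rw [Finset.mul_sum, ← Finset.sum_sub_distrib]
        refine Finset.sum_congr rfl fun μ _ => ?_
        ring

/-- The `d_{x²-y²}` case: **`‖Δ_d ψ‖² ≤ (40 L²/(n+1)) (n(n+1) ‖ψ‖² - Re ⟨ψ, S² ψ⟩)`** for every `ψ` of
the sector `(n, n)`. Scalapino, Phys. Rep. 250 (1995) 329, §2; Tasaki (1998) p. 20. [folklore] -/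
theorem re_normSq_pairField_dWave_mulVec_le_spinDeficit {n : ℕ} {ψ : Fock (Orb (FermionTorus 2 L))}
    (hψ : IsInSector n n ψ) :
    (star (pairField dWaveFormFactor L *ᵥ ψ) ⬝ᵥ (pairField dWaveFormFactor L *ᵥ ψ)).re ≤
      40 * (L : ℝ) ^ 2 / ((n : ℝ) + 1) *
        ((n : ℝ) * (n + 1) * (star ψ ⬝ᵥ ψ).re -
          (star ψ ⬝ᵥ ((spinSq : Matrix (Finset (Orb (FermionTorus 2 L))) _ ℂ) *ᵥ ψ)).re) := by
  have h := re_normSq_pairField_mulVec_le_spinDeficit dWaveFormFactor L hψ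
  rw [PairFieldYang.sum_sq_dWaveFormFactor] at h
  convert h using 2
  ring

end Operator

end Summit.HubbardSuperconductivity.HubbardSuperconductivity.Theorems.BirGroundStateAverageLRO.Negative
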